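import Literature.NumberTheory.Automorphic.MeyerThetaMellin
import Literature.Analysis.FunctionSpaces.GaussianSchwartz
import Mathlib.Analysis.SpecialFunctions.Gamma.Deligne
import HarnessLib

/-!
# Meyer's global difference representation — proofs, `K = ℚ`: the test function `G₀`

Topic `NumberTheory/Automorphic`; namespace `Literature.NumberTheory.Automorphic.Meyer`. Sibling
PROOF file for Step D of the plan for `Meyer.spectralRealisation_rat` [Meyer2005, Thm. 5.11]: an
explicit even Schwartz function on `ℝ`,

  `G₀(t) = (t⁴ − 3t²/(2π)) e^{−πt²}`,

with `G₀(0) = 0`, `∫ G₀ = 0` and Mellin transform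
`∫₀^∞ G₀(t) t^{s−1} dt = s(s−1)/(8π²) · π^{−s/2} Γ(s/2)` (`Re s > 0`), so that by Riemann's unfolding
(`mellin_tsum_int_ite`) `∫₀^∞ (∑_{n≠0} G₀(nt)) t^{s-1} dt = s(s−1) Λ(s)/(4π²)` for `Re s > 1`, where
`Λ = completedRiemannZeta`. This is the classical device (Riemann 1859; Tate's thesis for the
unramified character of `ℚ`) by which Meyer's summation map produces the completed zeta function
[Meyer2005, §5.7: "`L_K(χ, s)` is `\widehat{Σ f_χ}(χ|x|^s)` for suitably chosen `f_χ`"]; the polynomial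
factor kills the poles at `s = 0, 1` and makes `Σ(G₀ ⊗ 1_Ẑ)` lie in `H₊ ∩ H₋`.

* `meyerTestFun : 𝓢(ℝ, ℂ)` and `meyerTestFun_apply`, `meyerTestFun_zero`, `meyerTestFun_neg`;
* `mellin_gaussian` — `mellin (e^{−π t²}) s = ½ π^{−s/2} Γ(s/2)` (`Re s > 0`);
* **`mellin_meyerTestFun`** — `mellin G₀ s = s(s−1)/(8π²) · π^{−s/2} Γ(s/2)` (`Re s > 0`);
* `integral_meyerTestFun` — `∫ G₀ = 0`;
* **`mellin_theta_meyerTestFun`** — `mellin (∑_{n≠0} G₀(n·)) s = s(s−1)/(4π²) · Λ(s)` (`Re s > 1`).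

Everything is proved; the only definitions are the concrete test function and its polynomial
weight.

## References

* R. Meyer, *On a representation of the idele class group related to primes and zeros of
  L-functions*, Duke Math. J. 127 (2005) = arXiv:math/0311468, §5.7 [Meyer2005].
* J. Tate, *Fourier analysis in number fields and Hecke's zeta-functions* (1950), §2.5 (the
  unramified local computation at the real place).
-/

noncomputable section

open MeasureTheory Set Filter Complex
open scoped Topology Real

namespace Literature.NumberTheory.Automorphic.Meyer

/-- The polynomial weight `t⁴ − 3t²/(2π)` of the test function. [folklore] -/
def meyerWeight (t : ℝ) : ℝ := t ^ 4 - 3 / (2 * π) * t ^ 2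

/-- The weight has temperate growth (it is a polynomial). [folklore] -/
theorem meyerWeight_hasTemperateGrowth : Function.HasTemperateGrowth meyerWeight := by
  unfold meyerWeight
  fun_prop

/-- **The test function `G₀(t) = (t⁴ − 3t²/(2π)) e^{−πt²}`** as a Schwartz function on `ℝ`
(a temperate-growth multiple of the Gaussian `Literature.Analysis.FunctionSpaces.gaussianSchwartz`).
[cite: Meyer2005, §5.7] -/
def meyerTestFun : SchwartzMap ℝ ℂ :=
  SchwartzMap.smulLeftCLM ℂ meyerWeight (Literature.Analysis.FunctionSpaces.gaussianSchwartz ℝ π)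

/-- Values of `G₀`. [folklore] -/
theorem meyerTestFun_apply (t : ℝ) :
    meyerTestFun t = ((t ^ 4 - 3 / (2 * π) * t ^ 2 : ℝ) : ℂ) * (Real.exp (-π * t ^ 2) : ℂ) := by
  rw [meyerTestFun, SchwartzMap.smulLeftCLM_apply_apply meyerWeight_hasTemperateGrowth,
    Literature.Analysis.FunctionSpaces.gaussianSchwartz_apply Real.pi_pos, Real.norm_eq_abs, sq_abs,
    meyerWeight, Complex.real_smul]

/-- `G₀(0) = 0`. [folklore] -/
theorem meyerTestFun_zero : meyerTestFun 0 = 0 := by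
  rw [meyerTestFun_apply]
  simp

/-- `G₀` is even. [folklore] -/
theorem meyerTestFun_neg (t : ℝ) : meyerTestFun (-t) = meyerTestFun t := by
  rw [meyerTestFun_apply, meyerTestFun_apply]
  have h2 : (-t) ^ 2 = t ^ 2 := by ring
  have h4 : (-t) ^ 4 = t ^ 4 := by ring
  rw [h2, h4]

/-! ### Mellin transforms -/

/-- **Mellin transform of the Gaussian**: `∫₀^∞ e^{−πt²} t^{s−1} dt = ½ π^{−s/2} Γ(s/2)` for
`Re s > 0`. [folklore] -/
theorem mellin_gaussian {s : ℂ} (hs : 0 < s.re) :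
    mellin (fun t : ℝ => (Real.exp (-π * t ^ 2) : ℂ)) s = 1 / 2 * ((π : ℂ) ^ (-s / 2) * Gamma (s / 2)) := by
  have hfun : (fun t : ℝ => (Real.exp (-π * t ^ 2) : ℂ)) =
      fun t : ℝ => (fun u : ℝ => (Real.exp (-π * u) : ℂ)) (t ^ (2 : ℝ)) := by
    funext t
    simp only [Real.rpow_two]
  rw [hfun, mellin_comp_rpow (fun u : ℝ => (Real.exp (-π * u) : ℂ)) s 2]
  have hs2 : 0 < (s / 2).re := by
    rw [div_ofNat_re]; positivity
  have hI : mellin (fun u : ℝ => (Real.exp (-π * u) : ℂ)) (s / 2) = (1 / (π : ℂ)) ^ (s / 2) * Gamma (s / 2) := by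
    rw [mellin, ← integral_cpow_mul_exp_neg_mul_Ioi hs2 Real.pi_pos]
    refine setIntegral_congr_fun measurableSet_Ioi fun t _ => ?_
    rw [smul_eq_mul]
    push_cast
    ring_nf
  rw [show (s / ((2 : ℝ) : ℂ)) = s / 2 by norm_num, hI, Complex.real_smul]
  have hπ : ((π : ℂ)).arg ≠ π := by
    rw [arg_ofReal_of_nonneg Real.pi_pos.le]; exact Real.pi_ne_zero.symm
  rw [one_div, inv_cpow _ _ hπ, ← cpow_neg, neg_div]
  norm_num

/-- Mellin transform of `t^{k} e^{−πt²}` (`k = 2, 4`) via the shift rule. [folklore] -/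
theorem mellin_cpow_mul_gaussian {s : ℂ} (a : ℂ) (hs : 0 < (s + a).re) :
    mellin (fun t : ℝ => (t : ℂ) ^ a * (Real.exp (-π * t ^ 2) : ℂ)) s =
      1 / 2 * ((π : ℂ) ^ (-(s + a) / 2) * Gamma ((s + a) / 2)) := by
  rw [← mellin_gaussian hs, ← mellin_cpow_smul]
  rfl

/-- Convergence of the Mellin integral of `t^a e^{−πt²}` for `Re (s + a) > 0`. [folklore] -/
theorem mellinConvergent_cpow_mul_gaussian {s : ℂ} (a : ℂ) (hs : 0 < (s + a).re) :
    MellinConvergent (fun t : ℝ => (t : ℂ) ^ a * (Real.exp (-π * t ^ 2) : ℂ)) s := by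
  have h := mellinConvergent_schwartz (Literature.Analysis.FunctionSpaces.gaussianSchwartz ℝ π) hs
  rw [Literature.Analysis.FunctionSpaces.coe_gaussianSchwartz Real.pi_pos] at h
  have hfun : (fun x : ℝ => ((Real.exp (-π * ‖x‖ ^ 2) : ℝ) : ℂ)) = fun t : ℝ => (Real.exp (-π * t ^ 2) : ℂ) := by
    funext t
    rw [Real.norm_eq_abs, sq_abs]
  rw [hfun] at h
  exact (MellinConvergent.cpow_smul (f := fun t : ℝ => (Real.exp (-π * t ^ 2) : ℂ)) (a := a)).mpr h

/-- **The Mellin transform of `G₀`**: `∫₀^∞ G₀(t) t^{s−1} dt = s(s−1)/(8π²) · π^{−s/2} Γ(s/2)` for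
`Re s > 0`. [cite: Meyer2005, §5.7] -/
theorem mellin_meyerTestFun {s : ℂ} (hs : 0 < s.re) :
    mellin (fun t : ℝ => meyerTestFun t) s =
      s * (s - 1) / (8 * (π : ℂ) ^ 2) * ((π : ℂ) ^ (-s / 2) * Gamma (s / 2)) := by
  have h4 : 0 < (s + 4).re := by simp; linarith
  have h2 : 0 < (s + 2).re := by simp; linarith
  set c : ℂ := ((3 / (2 * π) : ℝ) : ℂ) with hc
  -- pointwise: `G₀(t) = t^4 e^{-πt²} - c t^2 e^{-πt²}` for `t > 0`
  have hpt : ∀ t ∈ Ioi (0 : ℝ), (t : ℂ) ^ (s - 1) • meyerTestFun t =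
      (t : ℂ) ^ (s - 1) • ((t : ℂ) ^ (4 : ℂ) * (Real.exp (-π * t ^ 2) : ℂ)) -
        c * ((t : ℂ) ^ (s - 1) • ((t : ℂ) ^ (2 : ℂ) * (Real.exp (-π * t ^ 2) : ℂ))) := by
    intro t _
    rw [meyerTestFun_apply, hc]
    have e4 : (t : ℂ) ^ (4 : ℂ) = (t : ℂ) ^ (4 : ℕ) := by exact_mod_cast Complex.cpow_natCast (t : ℂ) 4
    have e2 : (t : ℂ) ^ (2 : ℂ) = (t : ℂ) ^ (2 : ℕ) := by exact_mod_cast Complex.cpow_natCast (t : ℂ) 2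
    rw [e4, e2]
    push_cast
    simp only [smul_eq_mul]
    ring
  have hint4 := mellinConvergent_cpow_mul_gaussian (s := s) 4 h4
  have hint2 := mellinConvergent_cpow_mul_gaussian (s := s) 2 h2
  rw [mellin, setIntegral_congr_fun measurableSet_Ioi hpt, integral_sub hint4 (hint2.const_mul c),
    integral_const_mul]
  change mellin (fun t : ℝ => (t : ℂ) ^ (4 : ℂ) * (Real.exp (-π * t ^ 2) : ℂ)) s -
      c * mellin (fun t : ℝ => (t : ℂ) ^ (2 : ℂ) * (Real.exp (-π * t ^ 2) : ℂ)) s = _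
  rw [mellin_cpow_mul_gaussian 4 h4, mellin_cpow_mul_gaussian 2 h2]
  -- Gamma recursion and powers of `π`
  have hs0 : s / 2 ≠ 0 := by
    intro h
    have := congrArg Complex.re h
    rw [div_ofNat_re, zero_re] at this
    linarith
  have hs1 : s / 2 + 1 ≠ 0 := by
    intro h
    have := congrArg Complex.re h
    rw [add_re, div_ofNat_re, one_re, zero_re] at this
    linarith
  have hG2 : Gamma ((s + 2) / 2) = s / 2 * Gamma (s / 2) := by
    rw [show (s + 2) / 2 = s / 2 + 1 by ring, Complex.Gamma_add_one _ hs0]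
  have hG4 : Gamma ((s + 4) / 2) = (s / 2 + 1) * (s / 2) * Gamma (s / 2) := by
    rw [show (s + 4) / 2 = s / 2 + 1 + 1 by ring, Complex.Gamma_add_one _ hs1,
      Complex.Gamma_add_one _ hs0, mul_assoc]
  have hπ0 : (π : ℂ) ≠ 0 := ofReal_ne_zero.mpr Real.pi_ne_zero
  have hP2 : (π : ℂ) ^ (-(s + 2) / 2) = (π : ℂ) ^ (-s / 2) * (π : ℂ)⁻¹ := by
    rw [show -(s + 2) / 2 = -s / 2 + (-1) by ring, cpow_add _ _ hπ0, cpow_neg_one]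
  have hP4 : (π : ℂ) ^ (-(s + 4) / 2) = (π : ℂ) ^ (-s / 2) * ((π : ℂ) ^ 2)⁻¹ := by
    rw [show -(s + 4) / 2 = -s / 2 + (-2) by ring, cpow_add _ _ hπ0, cpow_neg]
    norm_cast
  rw [hG2, hG4, hP2, hP4, hc]
  push_cast
  field_simp
  ring

/-- `mellin G₀ 1 = ∫₀^∞ G₀ = 0`. [folklore] -/
theorem setIntegral_Ioi_meyerTestFun : ∫ t in Ioi (0 : ℝ), meyerTestFun t = 0 := by
  have h := mellin_meyerTestFun (s := 1) (by simp)
  rw [sub_self, mul_zero, zero_div, zero_mul, mellin] at h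
  rw [← h]
  refine setIntegral_congr_fun measurableSet_Ioi fun t _ => ?_
  rw [sub_self, cpow_zero, one_smul]

/-- **`∫ G₀ = 0`** (so `𝔉G₀(0) = 0`). [cite: Meyer2005, §5.7] -/
theorem integral_meyerTestFun : ∫ t : ℝ, meyerTestFun t = 0 := by
  have hint : Integrable (fun t : ℝ => meyerTestFun t) := meyerTestFun.integrable
  have hsplit : ∫ t : ℝ, meyerTestFun t =
      (∫ t in Iic (0 : ℝ), meyerTestFun t) + ∫ t in Ioi (0 : ℝ), meyerTestFun t := by
    rw [← setIntegral_union (Iic_disjoint_Ioi le_rfl) measurableSet_Ioi hint.integrableOn hint.integrableOn,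
      Iic_union_Ioi, setIntegral_univ]
  have hneg : ∫ t in Iic (0 : ℝ), meyerTestFun t = ∫ t in Ioi (0 : ℝ), meyerTestFun t := by
    rw [← neg_zero, ← integral_comp_neg_Ioi]
    simp only [neg_zero, meyerTestFun_neg]
  rw [hsplit, hneg, setIntegral_Ioi_meyerTestFun, add_zero]

/-- **Riemann's unfolding for `G₀`**: for `1 < Re s`,
`∫₀^∞ (∑_{n ≠ 0} G₀(nt)) t^{s−1} dt = s(s−1)/(4π²) · Λ(s)` with `Λ = completedRiemannZeta`
(`= π^{−s/2} Γ(s/2) ζ(s)`). [cite: Meyer2005, §5.7] -/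
theorem mellin_theta_meyerTestFun {s : ℂ} (hs : 1 < s.re) :
    mellin (fun t : ℝ => ∑' n : ℤ, if n = 0 then (0 : ℂ) else meyerTestFun (n * t)) s =
      s * (s - 1) / (4 * (π : ℂ) ^ 2) * completedRiemannZeta s := by
  have hs0 : s ≠ 0 := by
    rintro rfl
    simp at hs
    linarith
  have hpos : 0 < s.re := by linarith
  rw [mellin_tsum_int_ite meyerTestFun meyerTestFun_neg hs, mellin_meyerTestFun hpos,
    riemannZeta_def_of_ne_zero hs0, ← Gammaℝ_def]
  have hΓ : Gammaℝ s ≠ 0 := Gammaℝ_ne_zero_of_re_pos hpos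
  have hπ0 : (π : ℂ) ≠ 0 := ofReal_ne_zero.mpr Real.pi_ne_zero
  field_simp
  ring

end Literature.NumberTheory.Automorphic.Meyer
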